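import Literature.NumberTheory.Transcendental.KZCubeKite
import HarnessLib

/-!
# The cube calculus of end-regularised iterated integrals, V: bilinear corner charts

The four direction data of a BILINEAR CORNER CHART (divisors `φ_ℓ = A_ℓ + B_ℓ x + C_ℓ y + D_ℓ xy`
regular on the closed box `[0,α] × [0,β]`, axes `x = 0`, `y = 0`; `CornerChart`, `CornerChart.kite`)
satisfy the kite hypotheses of part IV (`CornerChart.kite_hyp`) as soon as the contracted
connections are flat at the rational points of the closed box and central on the edges through
the corner (hypotheses `F1Q`, `F2Q`, `F3Q`, `[Z₀, Z₁] = 0`, stated in the target algebra): the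
cross identifications and the degree-one closed-loop identity `b1_identity'` are identities of
rational functions of the bilinear chart.  The file also puts the word functions in SIMPLEX FORM
(`DirData.scale_mul_fn_Zw`: `c̄τ Z_v = ∏ᵢ (c̄τ∏_{j<i}x_j)/(c̄τ∏_{j≤i}x_j − poleᵢ)`, the pull-back of
`∏ dtᵢ/(tᵢ − poleᵢ)` along the cubical chart, Jacobian included) and records the vanishing of dead
words, the rational poles and constant values of rider-free data, and two bookkeeping lemmas on
`Shuffle.pair` / `Shuffle.regEnd` — the ingredients of the bridge between simplex families and
cube series [KontsevichZagier2001, §1.2].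

References: H. Furusho, Ann. of Math. 171 (2010), §3 [cite: Furusho2010, §3];
[cite: KontsevichZagier2001, §1.2]; [cite: IharaKanekoZagier2006, §3].
-/

noncomputable section

open MeasureTheory Set MvPolynomial
open Literature.ModelTheory.ExponentialFields (IsSemialgebraic analyticOnNhd_aeval continuous_aeval_real)
open Literature.NumberTheory.Transcendental

namespace Literature.NumberTheory.Transcendental.KZ.Cube

variable {M N : ℕ}

/-! ## Bilinear corner charts: the four direction data and their kite hypotheses -/

section CornerChart

open Shuffle NCSeries

variable {m : ℕ}

/-- **A bilinear corner chart**: divisors `φ_ℓ = A_ℓ + B_ℓ x + C_ℓ y + D_ℓ xy` (`ℓ : Fin m`) regular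
on the closed box `[0,α] × [0,β]` at the corner `(0,0)` of the axes `x = 0`, `y = 0`.
[cite: Furusho2010, §3] -/
structure CornerChart (m : ℕ) where
  /-- constant coefficients -/
  cA : Fin m → ℚ
  /-- `x`-coefficients -/
  cB : Fin m → ℚ
  /-- `y`-coefficients -/
  cC : Fin m → ℚ
  /-- `xy`-coefficients -/
  cD : Fin m → ℚ
  /-- the `x`-side of the box -/
  α : ℚ
  /-- the `y`-side of the box -/
  β : ℚ
  hα : 0 < α
  hβ : 0 < β
  /-- the divisors do not vanish on the closed box -/
  hreg : ∀ (ℓ : Fin m) (x y : ℝ), 0 ≤ x → x ≤ α → 0 ≤ y → y ≤ β → (cA ℓ : ℝ) + cB ℓ * x + cC ℓ * y + cD ℓ * x * y ≠ 0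

namespace CornerChart

variable (Γ : CornerChart m)

/-- The divisor `φ_ℓ(x,y)` over `ℝ`. [folklore] -/
def φ (ℓ : Fin m) (x y : ℝ) : ℝ := (Γ.cA ℓ : ℝ) + Γ.cB ℓ * x + Γ.cC ℓ * y + Γ.cD ℓ * x * y

/-- The transverse rider of one-rider data. [folklore] -/
abbrev Yv : MvPolynomial (Fin (0 + 1)) ℚ := X (Fin.last 0)

/-- **The `x`-direction data** at transverse position `y = β Y`: letters
`(B + Dβ Y) dt/((B + DβY) t + (A + Cβ Y))`, bound `α`, transverse derivative data `Y∂_Y`. [folklore] -/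
def Dx : DirData (Fin m) (0 + 1) where
  c := Γ.α
  hc := Γ.hα.le
  N := fun ℓ => MvPolynomial.C (Γ.cB ℓ) + MvPolynomial.C (Γ.cD ℓ * Γ.β) * Yv
  M := fun ℓ => MvPolynomial.C (Γ.cA ℓ) + MvPolynomial.C (Γ.cC ℓ * Γ.β) * Yv
  N' := fun ℓ => X (Fin.last 0) * pderiv (Fin.last 0) (MvPolynomial.C (Γ.cB ℓ) + MvPolynomial.C (Γ.cD ℓ * Γ.β) * Yv)
  M' := fun ℓ => X (Fin.last 0) * pderiv (Fin.last 0) (MvPolynomial.C (Γ.cA ℓ) + MvPolynomial.C (Γ.cC ℓ * Γ.β) * Yv)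
  reg := fun ℓ s hs t ht0 ht1 => by
    have hY := hs (Fin.last 0)
    have := Γ.hreg ℓ t (Γ.β * s (Fin.last 0)) ht0 ht1 (mul_nonneg (by exact_mod_cast Γ.hβ.le) hY.1)
      (by nlinarith [hY.2, Γ.hβ, show (0:ℝ) < Γ.β from by exact_mod_cast Γ.hβ])
    simp only [Yv, map_add, map_mul, MvPolynomial.aeval_C, aeval_X, eq_ratCast] at *
    push_cast at *
    convert this using 1; ring

/-- **The `x`-direction data at `y = 0`.** [folklore] -/
def D0x : DirData (Fin m) (0 + 1) where
  c := Γ.α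
  hc := Γ.hα.le
  N := fun ℓ => MvPolynomial.C (Γ.cB ℓ)
  M := fun ℓ => MvPolynomial.C (Γ.cA ℓ)
  N' := fun ℓ => X (Fin.last 0) * pderiv (Fin.last 0) (MvPolynomial.C (Γ.cB ℓ))
  M' := fun ℓ => X (Fin.last 0) * pderiv (Fin.last 0) (MvPolynomial.C (Γ.cA ℓ))
  reg := fun ℓ s _ t ht0 ht1 => by
    have := Γ.hreg ℓ t 0 ht0 ht1 le_rfl (by exact_mod_cast Γ.hβ.le)
    simp only [MvPolynomial.aeval_C, eq_ratCast] at *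
    convert this using 1; ring

/-- **The `y`-direction data** at transverse position `x = α X`. [folklore] -/
def Dy : DirData (Fin m) (0 + 1) where
  c := Γ.β
  hc := Γ.hβ.le
  N := fun ℓ => MvPolynomial.C (Γ.cC ℓ) + MvPolynomial.C (Γ.cD ℓ * Γ.α) * Yv
  M := fun ℓ => MvPolynomial.C (Γ.cA ℓ) + MvPolynomial.C (Γ.cB ℓ * Γ.α) * Yv
  N' := fun ℓ => X (Fin.last 0) * pderiv (Fin.last 0) (MvPolynomial.C (Γ.cC ℓ) + MvPolynomial.C (Γ.cD ℓ * Γ.α) * Yv)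
  M' := fun ℓ => X (Fin.last 0) * pderiv (Fin.last 0) (MvPolynomial.C (Γ.cA ℓ) + MvPolynomial.C (Γ.cB ℓ * Γ.α) * Yv)
  reg := fun ℓ s hs t ht0 ht1 => by
    have hX := hs (Fin.last 0)
    have := Γ.hreg ℓ (Γ.α * s (Fin.last 0)) t (mul_nonneg (by exact_mod_cast Γ.hα.le) hX.1)
      (by nlinarith [hX.2, Γ.hα, show (0:ℝ) < Γ.α from by exact_mod_cast Γ.hα]) ht0 ht1
    simp only [Yv, map_add, map_mul, MvPolynomial.aeval_C, aeval_X, eq_ratCast] at *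
    push_cast at *
    convert this using 1; ring

/-- **The `y`-direction data at `x = 0`.** [folklore] -/
def D0y : DirData (Fin m) (0 + 1) where
  c := Γ.β
  hc := Γ.hβ.le
  N := fun ℓ => MvPolynomial.C (Γ.cC ℓ)
  M := fun ℓ => MvPolynomial.C (Γ.cA ℓ)
  N' := fun ℓ => X (Fin.last 0) * pderiv (Fin.last 0) (MvPolynomial.C (Γ.cC ℓ))
  M' := fun ℓ => X (Fin.last 0) * pderiv (Fin.last 0) (MvPolynomial.C (Γ.cA ℓ))
  reg := fun ℓ s _ t ht0 ht1 => by
    have := Γ.hreg ℓ 0 t le_rfl (by exact_mod_cast Γ.hα.le) ht0 ht1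
    simp only [MvPolynomial.aeval_C, eq_ratCast] at *
    convert this using 1; ring

/-- **The kite of a bilinear corner chart.** [folklore] -/
def kite : KiteData (Fin m) 0 := ⟨Γ.Dy, Γ.Dx, Γ.D0y, Γ.D0x⟩

/-! ### Values of the substituted letter data -/

variable {k : ℕ} (π : MvPolynomial (Fin (0 + k)) ℚ) (hπ : IsScale π)

omit hπ in
/-- Evaluating the substituted affine letter data over `ℝ`. [folklore] -/
theorem aeval_substY_affine (a b : ℚ) (e : Fin (0 + k) → ℝ) :
    aeval e (bind₁ (riderSubstY π) (MvPolynomial.C a + MvPolynomial.C b * Yv)) = a + b * aeval e π := by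
  rw [aeval_bind₁_riderSubstY]
  simp only [Yv, map_add, map_mul, MvPolynomial.aeval_C, aeval_X, eq_ratCast, Fin.snoc_last]

omit hπ in
/-- Evaluating the substituted derivative data over `ℝ`. [folklore] -/
theorem aeval_substY_deriv (a b : ℚ) (e : Fin (0 + k) → ℝ) :
    aeval e (bind₁ (riderSubstY π) (X (Fin.last 0) * pderiv (Fin.last 0) (MvPolynomial.C a + MvPolynomial.C b * Yv))) = b * aeval e π := by
  rw [aeval_bind₁_riderSubstY]
  simp only [Yv, map_add, map_mul, MvPolynomial.aeval_C, aeval_X, eq_ratCast, Fin.snoc_last, Derivation.leibniz, pderiv_C,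
    pderiv_X, Pi.single_eq_same, smul_eq_mul, mul_one, zero_add, mul_zero, add_zero]
  ring

omit hπ in
/-- Evaluating substituted constant data. [folklore] -/
theorem aeval_substY_const (a : ℚ) (e : Fin (0 + k) → ℝ) : aeval e (bind₁ (riderSubstY π) (C a : MvPolynomial (Fin (0 + 1)) ℚ)) = a := by
  rw [aeval_bind₁_riderSubstY, MvPolynomial.aeval_C, eq_ratCast]

omit hπ in
/-- Evaluating substituted derivative of constant data. [folklore] -/
theorem aeval_substY_deriv_const (a : ℚ) (e : Fin (0 + k) → ℝ) :
    aeval e (bind₁ (riderSubstY π) (X (Fin.last 0) * pderiv (Fin.last 0) (C a : MvPolynomial (Fin (0 + 1)) ℚ))) = 0 := by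
  rw [aeval_bind₁_riderSubstY]; simp

/-! ### Rational values of the substituted data -/

omit hπ in
/-- Evaluating the substituted affine letter data over `ℚ`. [folklore] -/
theorem eval_substY_affine (a b : ℚ) (w : Fin (0 + k) → ℚ) :
    MvPolynomial.eval w (bind₁ (riderSubstY π) (MvPolynomial.C a + MvPolynomial.C b * Yv)) = a + b * MvPolynomial.eval w π := by
  have h := aeval_substY_affine π a b (fun i => (w i : ℝ))
  rw [aeval_ratCast, aeval_ratCast] at h
  exact_mod_cast h

omit hπ in
/-- Evaluating the substituted derivative data over `ℚ`. [folklore] -/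
theorem eval_substY_deriv (a b : ℚ) (w : Fin (0 + k) → ℚ) :
    MvPolynomial.eval w (bind₁ (riderSubstY π) (X (Fin.last 0) * pderiv (Fin.last 0) (MvPolynomial.C a + MvPolynomial.C b * Yv))) =
      b * MvPolynomial.eval w π := by
  have h := aeval_substY_deriv π a b (fun i => (w i : ℝ))
  rw [aeval_ratCast, aeval_ratCast] at h
  exact_mod_cast h

omit hπ in
/-- Evaluating substituted constant data over `ℚ`. [folklore] -/
theorem eval_substY_const (a : ℚ) (w : Fin (0 + k) → ℚ) :
    MvPolynomial.eval w (bind₁ (riderSubstY π) (MvPolynomial.C a : MvPolynomial (Fin (0 + 1)) ℚ)) = a := by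
  have h := aeval_substY_const π a (fun i => (w i : ℝ))
  rw [aeval_ratCast] at h
  exact_mod_cast h

/-- The divisor over `ℚ`. [folklore] -/
def φQ (ℓ : Fin m) (x y : ℚ) : ℚ := Γ.cA ℓ + Γ.cB ℓ * x + Γ.cC ℓ * y + Γ.cD ℓ * x * y

/-- The rider scale value `P(w) = π(riders of w)` over `ℚ`. [folklore] -/
def Pq (w : Fin ((0 + k) + 1) → ℚ) : ℚ := MvPolynomial.eval (fun i => w (Fin.castSucc i)) π

omit hπ in
/-- The rider scale value lies in `[0,1]` at points of the cube. [folklore] -/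
theorem Pq_mem (hπ : IsScale π) {w : Fin ((0 + k) + 1) → ℚ} (hw : ∀ i, 0 < w i ∧ w i < 1) : 0 ≤ Pq π w ∧ Pq π w ≤ 1 := by
  have h := hπ (fun i => ((w (Fin.castSucc i) : ℚ) : ℝ)) fun i => by
    constructor
    · show (0 : ℝ) ≤ (w (Fin.castSucc i) : ℝ); exact_mod_cast (hw (Fin.castSucc i)).1.le
    · show (w (Fin.castSucc i) : ℝ) ≤ 1; exact_mod_cast (hw (Fin.castSucc i)).2.le
  rw [aeval_ratCast] at h
  exact ⟨by exact_mod_cast h.1, by exact_mod_cast h.2⟩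

/-- The connection coefficient of the `x`-data: `c_ℓ = x(B + Dy)/φ` at `x = α s`, `y = β P`. [folklore] -/
theorem cq_Dx (ℓ : Fin m) (w : Fin ((0 + k) + 1) → ℚ) :
    (Γ.Dx.substY π hπ).cq ℓ w = (Γ.cB ℓ + Γ.cD ℓ * (Γ.β * Pq π w)) * (Γ.α * w (Fin.last _)) / Γ.φQ ℓ (Γ.α * w (Fin.last _)) (Γ.β * Pq π w) := by
  simp only [DirData.cq, DirData.Nq, DirData.Mq, DirData.uq, DirData.substY, Dx, eval_substY_affine, Pq, φQ]
  ring

/-- The transverse coefficient of the `x`-data: `e_ℓ = y(C + Dx)/φ`. [folklore] -/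
theorem eq_Dx (ℓ : Fin m) (w : Fin ((0 + k) + 1) → ℚ) :
    (Γ.Dx.substY π hπ).eq ℓ w = (Γ.cC ℓ + Γ.cD ℓ * (Γ.α * w (Fin.last _))) * (Γ.β * Pq π w) / Γ.φQ ℓ (Γ.α * w (Fin.last _)) (Γ.β * Pq π w) := by
  simp only [DirData.eq, DirData.Nq, DirData.Mq, DirData.N'q, DirData.M'q, DirData.uq, DirData.substY, Dx, eval_substY_affine,
    eval_substY_deriv, Pq, φQ]
  ring

/-- The connection coefficient of the `y`-data: `c_ℓ = y(C + Dx)/φ` at `y = β s`, `x = α P`. [folklore] -/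
theorem cq_Dy (ℓ : Fin m) (w : Fin ((0 + k) + 1) → ℚ) :
    (Γ.Dy.substY π hπ).cq ℓ w = (Γ.cC ℓ + Γ.cD ℓ * (Γ.α * Pq π w)) * (Γ.β * w (Fin.last _)) / Γ.φQ ℓ (Γ.α * Pq π w) (Γ.β * w (Fin.last _)) := by
  simp only [DirData.cq, DirData.Nq, DirData.Mq, DirData.uq, DirData.substY, Dy, eval_substY_affine, Pq, φQ]
  ring

/-- The transverse coefficient of the `y`-data: `e_ℓ = x(B + Dy)/φ`. [folklore] -/
theorem eq_Dy (ℓ : Fin m) (w : Fin ((0 + k) + 1) → ℚ) :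
    (Γ.Dy.substY π hπ).eq ℓ w = (Γ.cB ℓ + Γ.cD ℓ * (Γ.β * w (Fin.last _))) * (Γ.α * Pq π w) / Γ.φQ ℓ (Γ.α * Pq π w) (Γ.β * w (Fin.last _)) := by
  simp only [DirData.eq, DirData.Nq, DirData.Mq, DirData.N'q, DirData.M'q, DirData.uq, DirData.substY, Dy, eval_substY_affine,
    eval_substY_deriv, Pq, φQ]
  ring

/-- The connection coefficient of the `y`-data at `x = 0`. [folklore] -/
theorem cq_D0y (ℓ : Fin m) (w : Fin ((0 + k) + 1) → ℚ) :
    (Γ.D0y.substY π hπ).cq ℓ w = Γ.cC ℓ * (Γ.β * w (Fin.last _)) / (Γ.cA ℓ + Γ.cC ℓ * (Γ.β * w (Fin.last _))) := by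
  simp only [DirData.cq, DirData.Nq, DirData.Mq, DirData.uq, DirData.substY, D0y, eval_substY_const]
  ring

/-- The connection coefficient of the `x`-data at `y = 0`. [folklore] -/
theorem cq_D0x (ℓ : Fin m) (w : Fin ((0 + k) + 1) → ℚ) :
    (Γ.D0x.substY π hπ).cq ℓ w = Γ.cB ℓ * (Γ.α * w (Fin.last _)) / (Γ.cA ℓ + Γ.cB ℓ * (Γ.α * w (Fin.last _))) := by
  simp only [DirData.cq, DirData.Nq, DirData.Mq, DirData.uq, DirData.substY, D0x, eval_substY_const]
  ring

/-! ### Real values at the scale point -/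

omit hπ in
/-- The riders of the scale point are the given point. [folklore] -/
theorem init_spt (e : Fin ((0 + k) + 0) → ℝ) : Fin.init (spt π e) = fun j => e (Fin.castAdd 0 j) := by
  funext j; simp [spt, Fin.init]

omit hπ in
/-- The scale value read along `Fin.castAdd 0` is the scale value. [folklore] -/
theorem aeval_castAdd0 (e : Fin ((0 + k) + 0) → ℝ) : aeval (fun j : Fin (0 + k) => e (Fin.castAdd 0 j)) π = aeval e π := rfl

omit hπ in
/-- The last coordinate of the scale point. [folklore] -/
theorem spt_last (e : Fin ((0 + k) + 0) → ℝ) : spt π e (Fin.last _) = aeval e π := by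
  simp [spt]

/-- Abbreviation: the real scale value. [folklore] -/
abbrev Pr (e : Fin ((0 + k) + 0) → ℝ) : ℝ := aeval e π

omit hπ in
/-- The real scale value lies in `[0,1]` on the cube. [folklore] -/
theorem Pr_mem (hπ : IsScale π) {e : Fin ((0 + k) + 0) → ℝ} (he : e ∈ KZ.cube ((0 + k) + 0)) : 0 ≤ Pr π e ∧ Pr π e ≤ 1 :=
  hπ e he

/-- The real letter values of the four substituted data at the scale point. [folklore] -/
theorem vals_spt (ℓ : Fin m) (e : Fin ((0 + k) + 0) → ℝ) :
    (Γ.Dx.substY π hπ).Nr ℓ (spt π e) = Γ.cB ℓ + Γ.cD ℓ * Γ.β * Pr π e ∧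
    (Γ.Dx.substY π hπ).Mr ℓ (spt π e) = Γ.cA ℓ + Γ.cC ℓ * Γ.β * Pr π e ∧
    (Γ.Dx.substY π hπ).N'r ℓ (spt π e) = Γ.cD ℓ * Γ.β * Pr π e ∧
    (Γ.Dx.substY π hπ).M'r ℓ (spt π e) = Γ.cC ℓ * Γ.β * Pr π e ∧
    (Γ.Dx.substY π hπ).ur (spt π e) = Γ.α * Pr π e ∧
    (Γ.Dy.substY π hπ).Nr ℓ (spt π e) = Γ.cC ℓ + Γ.cD ℓ * Γ.α * Pr π e ∧
    (Γ.Dy.substY π hπ).Mr ℓ (spt π e) = Γ.cA ℓ + Γ.cB ℓ * Γ.α * Pr π e ∧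
    (Γ.Dy.substY π hπ).N'r ℓ (spt π e) = Γ.cD ℓ * Γ.α * Pr π e ∧
    (Γ.Dy.substY π hπ).M'r ℓ (spt π e) = Γ.cB ℓ * Γ.α * Pr π e ∧
    (Γ.Dy.substY π hπ).ur (spt π e) = Γ.β * Pr π e ∧
    (Γ.D0x.substY π hπ).Nr ℓ (spt π e) = Γ.cB ℓ ∧ (Γ.D0x.substY π hπ).Mr ℓ (spt π e) = Γ.cA ℓ ∧
    (Γ.D0x.substY π hπ).ur (spt π e) = Γ.α * Pr π e ∧
    (Γ.D0y.substY π hπ).Nr ℓ (spt π e) = Γ.cC ℓ ∧ (Γ.D0y.substY π hπ).Mr ℓ (spt π e) = Γ.cA ℓ ∧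
    (Γ.D0y.substY π hπ).ur (spt π e) = Γ.β * Pr π e := by
  simp only [DirData.Nr, DirData.Mr, DirData.N'r, DirData.M'r, DirData.ur, DirData.substY, Dx, Dy, D0x, D0y, init_spt,
    aeval_substY_affine, aeval_substY_deriv, aeval_substY_const, aeval_castAdd0, spt_last, Pr]
  push_cast
  refine ⟨by ring, by ring, by ring, by ring, trivial, by ring, by ring, by ring, by ring, trivial, trivial, trivial, trivial, trivial, trivial, trivial⟩

/-! ### The kite hypotheses of a bilinear corner chart -/

omit π hπ in
/-- Nonvanishing of the divisor at a point of the closed box, in any ring-equal form. [folklore] -/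
theorem φ_ne (ℓ : Fin m) {x y : ℝ} (hx : 0 ≤ x ∧ x ≤ Γ.α) (hy : 0 ≤ y ∧ y ≤ Γ.β) {D : ℝ}
    (hD : D = (Γ.cA ℓ : ℝ) + Γ.cB ℓ * x + Γ.cC ℓ * y + Γ.cD ℓ * x * y) : D ≠ 0 := by
  rw [hD]; exact Γ.hreg ℓ x y hx.1 hx.2 hy.1 hy.2

omit π hπ in
/-- Bounds of `α P` for `P ∈ [0,1]`. [folklore] -/
theorem αP_mem {P : ℝ} (hP : 0 ≤ P ∧ P ≤ 1) : 0 ≤ (Γ.α : ℝ) * P ∧ (Γ.α : ℝ) * P ≤ Γ.α :=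
  have hα : (0 : ℝ) < Γ.α := by exact_mod_cast Γ.hα
  ⟨mul_nonneg hα.le hP.1, by nlinarith [hP.2]⟩

omit π hπ in
/-- Bounds of `β P` for `P ∈ [0,1]`. [folklore] -/
theorem βP_mem {P : ℝ} (hP : 0 ≤ P ∧ P ≤ 1) : 0 ≤ (Γ.β : ℝ) * P ∧ (Γ.β : ℝ) * P ≤ Γ.β :=
  have hβ : (0 : ℝ) < Γ.β := by exact_mod_cast Γ.hβ
  ⟨mul_nonneg hβ.le hP.1, by nlinarith [hP.2]⟩

omit π hπ in
/-- The degree-one closed-loop identity of a bilinear chart at a diagonal point (pure field algebra). [folklore] -/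
theorem b1_identity' (a b c d al be P : ℝ)
    (h1 : a + b * (al * P) + c * (be * P) + d * (al * P) * (be * P) ≠ 0) (h2 : a + b * (al * P) ≠ 0) (h3 : a + c * (be * P) ≠ 0) :
    be * ((c + d * al * P) / ((c + d * al * P) * (be * P) + (a + b * al * P)) +
        ((d * al * P) * (a + b * al * P) - (b * al * P) * (c + d * al * P)) / (((c + d * al * P) * (be * P) + (a + b * al * P)) * (a + b * al * P)) -
        c / (c * (be * P) + a)) =
    al * ((b + d * be * P) / ((b + d * be * P) * (al * P) + (a + c * be * P)) +
        ((d * be * P) * (a + c * be * P) - (c * be * P) * (b + d * be * P)) / (((b + d * be * P) * (al * P) + (a + c * be * P)) * (a + c * be * P)) -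
        b / (b * (al * P) + a)) := by
  have d1 : (c + d * al * P) * (be * P) + (a + b * al * P) ≠ 0 := fun h => h1 (by linear_combination h)
  have d2 : a + b * al * P ≠ 0 := fun h => h2 (by linear_combination h)
  have d3 : c * (be * P) + a ≠ 0 := fun h => h3 (by linear_combination h)
  have d4 : (b + d * be * P) * (al * P) + (a + c * be * P) ≠ 0 := fun h => h1 (by linear_combination h)
  have d5 : a + c * be * P ≠ 0 := fun h => h3 (by linear_combination h)
  have d6 : b * (al * P) + a ≠ 0 := fun h => h2 (by linear_combination h)
  rw [div_add_div _ _ d1 (mul_ne_zero d1 d2), div_sub_div _ _ (mul_ne_zero d1 (mul_ne_zero d1 d2)) d3,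
    div_add_div _ _ d4 (mul_ne_zero d4 d5), div_sub_div _ _ (mul_ne_zero d4 (mul_ne_zero d4 d5)) d6,
    mul_div_assoc', mul_div_assoc',
    div_eq_div_iff (mul_ne_zero (mul_ne_zero d1 (mul_ne_zero d1 d2)) d3) (mul_ne_zero (mul_ne_zero d4 (mul_ne_zero d4 d5)) d6)]
  ring

omit π hπ in
/-- **The kite hypotheses of a flat, axis-central bilinear corner chart.** [cite: Furusho2010, §3] -/
theorem kite_hyp {R : Type} [CommRing R] [Algebra ℚ R] {A : Type} [Ring A] [Algebra R A]
    (t : Fin m → A) (tX tY : A) (h01 : Commute tX tY)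
    (F1Q : ∀ x y : ℚ, 0 ≤ x → x ≤ Γ.α → 0 ≤ y → y ≤ Γ.β →
      Commute (tX + ∑ ℓ, algebraMap ℚ R ((Γ.cB ℓ + Γ.cD ℓ * y) * x / Γ.φQ ℓ x y) • t ℓ)
        (tY + ∑ ℓ, algebraMap ℚ R ((Γ.cC ℓ + Γ.cD ℓ * x) * y / Γ.φQ ℓ x y) • t ℓ))
    (F2Q : ∀ y : ℚ, 0 < y → y < Γ.β → Commute tX (tY + ∑ ℓ, algebraMap ℚ R (Γ.cC ℓ * y / (Γ.cA ℓ + Γ.cC ℓ * y)) • t ℓ))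
    (F3Q : ∀ x : ℚ, 0 < x → x < Γ.α → Commute tY (tX + ∑ ℓ, algebraMap ℚ R (Γ.cB ℓ * x / (Γ.cA ℓ + Γ.cB ℓ * x)) • t ℓ)) :
    Γ.kite.Hyp R Γ.α Γ.β t tX tY := by
  have hα : (0 : ℝ) < Γ.α := by exact_mod_cast Γ.hα
  have hβ : (0 : ℝ) < Γ.β := by exact_mod_cast Γ.hβ
  refine ⟨Γ.hα, Γ.hβ, rfl, rfl, rfl, rfl, fun ℓ => ⟨rfl, rfl⟩, fun ℓ => ⟨rfl, rfl⟩, fun ℓ => ⟨rfl, rfl⟩, fun ℓ => ⟨rfl, rfl⟩,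
    fun ℓ => ⟨by simp [kite, D0y], by simp [kite, D0y]⟩,
    fun ℓ => ⟨by simp [kite, D0x], by simp [kite, D0x]⟩, ?_, ?_, ?_, ?_, ?_, ?_, ?_, ?_, ?_⟩
  · -- flatY
    intro k π hπ w hw
    have hP := Pq_mem π hπ hw
    have hs := hw (Fin.last _)
    rw [DirData.Om, DirData.OmT]
    simp only [resid_none, resid_some, kite, cq_Dy, eq_Dy]
    exact (F1Q _ _ (mul_nonneg Γ.hα.le hP.1) (mul_le_of_le_one_right Γ.hα.le hP.2) (mul_nonneg Γ.hβ.le hs.1.le)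
      (mul_le_of_le_one_right Γ.hβ.le hs.2.le)).symm
  · -- flatX
    intro k π hπ w hw
    have hP := Pq_mem π hπ hw
    have hs := hw (Fin.last _)
    rw [DirData.Om, DirData.OmT]
    simp only [resid_none, resid_some, kite, cq_Dx, eq_Dx]
    exact F1Q _ _ (mul_nonneg Γ.hα.le hs.1.le) (mul_le_of_le_one_right Γ.hα.le hs.2.le) (mul_nonneg Γ.hβ.le hP.1)
      (mul_le_of_le_one_right Γ.hβ.le hP.2)
  · -- ax0y
    intro k π hπ
    refine ⟨h01, fun w hw => ?_⟩
    have hs := hw (Fin.last _)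
    rw [DirData.Om]
    simp only [resid_none, resid_some, kite, cq_D0y]
    exact F2Q _ (mul_pos Γ.hβ hs.1) (mul_lt_of_lt_one_right Γ.hβ hs.2)
  · -- ax0x
    intro k π hπ
    refine ⟨h01.symm, fun w hw => ?_⟩
    have hs := hw (Fin.last _)
    rw [DirData.Om]
    simp only [resid_none, resid_some, kite, cq_D0x]
    exact F3Q _ (mul_pos Γ.hα hs.1) (mul_lt_of_lt_one_right Γ.hα hs.2)
  · -- Iy
    intro k π hπ ℓ e he
    have hP := Pr_mem π hπ he
    obtain ⟨v1, v2, v3, v4, v5, v6, v7, v8, v9, v10, v11, v12, v13, v14, v15, v16⟩ := Γ.vals_spt π hπ ℓ e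
    show ((Γ.Dy.substY π hπ).eS ℓ).fn (spt π e) = (headS (Γ.Dx.substY π hπ).c (Γ.Dx.substY π hπ).hc
      ((Γ.Dx.substY π hπ).d (some ℓ)) ((Γ.Dx.substY π hπ).hd (some ℓ))).fn (spt π e)
    rw [DirData.fn_eS, DirData.fn_headS_some, v1, v2, v5, v6, v7, v8, v9, v10,
      div_eq_div_iff (Γ.φ_ne ℓ (Γ.αP_mem hP) (Γ.βP_mem hP) (by ring)) (Γ.φ_ne ℓ (Γ.αP_mem hP) (Γ.βP_mem hP) (by ring))]
    ring
  · -- Ix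
    intro k π hπ ℓ e he
    have hP := Pr_mem π hπ he
    obtain ⟨v1, v2, v3, v4, v5, v6, v7, v8, v9, v10, v11, v12, v13, v14, v15, v16⟩ := Γ.vals_spt π hπ ℓ e
    show ((Γ.Dx.substY π hπ).eS ℓ).fn (spt π e) = (headS (Γ.Dy.substY π hπ).c (Γ.Dy.substY π hπ).hc
      ((Γ.Dy.substY π hπ).d (some ℓ)) ((Γ.Dy.substY π hπ).hd (some ℓ))).fn (spt π e)
    rw [DirData.fn_eS, DirData.fn_headS_some, v1, v2, v3, v4, v5, v6, v7, v10,
      div_eq_div_iff (Γ.φ_ne ℓ (Γ.αP_mem hP) (Γ.βP_mem hP) (by ring)) (Γ.φ_ne ℓ (Γ.αP_mem hP) (Γ.βP_mem hP) (by ring))]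
    ring
  · -- Iy0
    intro k π hπ ℓ e he
    have hP := Pr_mem π hπ he
    obtain ⟨v1, v2, v3, v4, v5, v6, v7, v8, v9, v10, v11, v12, v13, v14, v15, v16⟩ := Γ.vals_spt π hπ ℓ e
    show ((Γ.Dy.substY π hπ).e0S ℓ).fn (spt π e) = (headS (Γ.D0x.substY π hπ).c (Γ.D0x.substY π hπ).hc
      ((Γ.D0x.substY π hπ).d (some ℓ)) ((Γ.D0x.substY π hπ).hd (some ℓ))).fn (spt π e)
    rw [DirData.fn_e0S, DirData.fn_headS_some, v7, v9, v11, v12, v13,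
      div_eq_div_iff (Γ.φ_ne ℓ (Γ.αP_mem hP) ⟨le_rfl, hβ.le⟩ (by ring)) (Γ.φ_ne ℓ (Γ.αP_mem hP) ⟨le_rfl, hβ.le⟩ (by ring))]
    ring
  · -- Ix0
    intro k π hπ ℓ e he
    have hP := Pr_mem π hπ he
    obtain ⟨v1, v2, v3, v4, v5, v6, v7, v8, v9, v10, v11, v12, v13, v14, v15, v16⟩ := Γ.vals_spt π hπ ℓ e
    show ((Γ.Dx.substY π hπ).e0S ℓ).fn (spt π e) = (headS (Γ.D0y.substY π hπ).c (Γ.D0y.substY π hπ).hc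
      ((Γ.D0y.substY π hπ).d (some ℓ)) ((Γ.D0y.substY π hπ).hd (some ℓ))).fn (spt π e)
    rw [DirData.fn_e0S, DirData.fn_headS_some, v2, v4, v14, v15, v16,
      div_eq_div_iff (Γ.φ_ne ℓ ⟨le_rfl, hα.le⟩ (Γ.βP_mem hP) (by ring)) (Γ.φ_ne ℓ ⟨le_rfl, hα.le⟩ (Γ.βP_mem hP) (by ring))]
    ring
  · -- B1
    intro k π hπ ℓ e he
    have hP := Pr_mem π hπ he
    obtain ⟨v1, v2, v3, v4, v5, v6, v7, v8, v9, v10, v11, v12, v13, v14, v15, v16⟩ := Γ.vals_spt π hπ ℓ e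
    show (Γ.β : ℝ) * ((lastS (Γ.Dy.substY π hπ).c (Γ.Dy.substY π hπ).hc ((Γ.Dy.substY π hπ).d (some ℓ))
        ((Γ.Dy.substY π hπ).hd (some ℓ))).fn (spt π e) + ((Γ.Dy.substY π hπ).ebrS ℓ).fn (spt π e) -
        (lastS (Γ.D0y.substY π hπ).c (Γ.D0y.substY π hπ).hc ((Γ.D0y.substY π hπ).d (some ℓ)) ((Γ.D0y.substY π hπ).hd (some ℓ))).fn (spt π e)) =
      (Γ.α : ℝ) * ((lastS (Γ.Dx.substY π hπ).c (Γ.Dx.substY π hπ).hc ((Γ.Dx.substY π hπ).d (some ℓ))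
        ((Γ.Dx.substY π hπ).hd (some ℓ))).fn (spt π e) + ((Γ.Dx.substY π hπ).ebrS ℓ).fn (spt π e) -
        (lastS (Γ.D0x.substY π hπ).c (Γ.D0x.substY π hπ).hc ((Γ.D0x.substY π hπ).d (some ℓ)) ((Γ.D0x.substY π hπ).hd (some ℓ))).fn (spt π e))
    rw [DirData.fn_lastS_some, DirData.fn_lastS_some, DirData.fn_lastS_some, DirData.fn_lastS_some, DirData.fn_ebrS, DirData.fn_ebrS,
      v1, v2, v3, v4, v5, v6, v7, v8, v9, v10, v11, v12, v13, v14, v15, v16]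
    have h1 := Γ.φ_ne ℓ (Γ.αP_mem hP) (Γ.βP_mem hP) (D := (Γ.cA ℓ : ℝ) + Γ.cB ℓ * (Γ.α * Pr π e) + Γ.cC ℓ * (Γ.β * Pr π e) +
      Γ.cD ℓ * (Γ.α * Pr π e) * (Γ.β * Pr π e)) rfl
    have h2 := Γ.φ_ne ℓ (Γ.αP_mem hP) ⟨le_rfl, hβ.le⟩ (D := (Γ.cA ℓ : ℝ) + Γ.cB ℓ * (Γ.α * Pr π e)) (by ring)
    have h3 := Γ.φ_ne ℓ ⟨le_rfl, hα.le⟩ (Γ.βP_mem hP) (D := (Γ.cA ℓ : ℝ) + Γ.cC ℓ * (Γ.β * Pr π e)) (by ring)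
    exact b1_identity' _ _ _ _ _ _ _ h1 h2 h3

end CornerChart

end CornerChart

/-! ## The word functions in closed form: scaled cube form versus simplex form -/

section ClosedForm

variable {ι : Type} {mm : ℕ}

/-- Lower partial products `∏_{j ≤ i} x_j`. [folklore] -/
def pprodLe {n : ℕ} (x : Fin n → ℝ) (i : Fin n) : ℝ := ∏ j ∈ Finset.univ.filter (fun j : Fin n => j ≤ i), x j

/-- Strict lower partial products `∏_{j < i} x_j`. [folklore] -/
def pprodLt {n : ℕ} (x : Fin n → ℝ) (i : Fin n) : ℝ := ∏ j ∈ Finset.univ.filter (fun j : Fin n => j < i), x j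

/-- `∏_{j ≤ 0} x_j = x_0`. [folklore] -/
theorem pprodLe_zero {n : ℕ} (x : Fin (n + 1) → ℝ) : pprodLe x 0 = x 0 := by
  rw [pprodLe, Finset.prod_filter, Fin.prod_univ_succ, if_pos le_rfl, Finset.prod_eq_one fun j _ => if_neg (by simp),
    mul_one]

/-- `∏_{j < 0} x_j = 1`. [folklore] -/
theorem pprodLt_zero {n : ℕ} (x : Fin (n + 1) → ℝ) : pprodLt x 0 = 1 := by
  rw [pprodLt, Finset.prod_filter]; exact Finset.prod_eq_one fun j _ => if_neg (Fin.not_lt_zero j)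

/-- `∏_{j ≤ i+1} x_j = x_0 ∏_{j ≤ i} x_{j+1}`. [folklore] -/
theorem pprodLe_succ {n : ℕ} (x : Fin (n + 1) → ℝ) (i : Fin n) : pprodLe x i.succ = x 0 * pprodLe (fun j => x j.succ) i := by
  rw [pprodLe, pprodLe, Finset.prod_filter, Finset.prod_filter, Fin.prod_univ_succ, if_pos (Fin.zero_le _)]
  congr 1
  exact Finset.prod_congr rfl fun j _ => by simp only [Fin.succ_le_succ_iff]

/-- `∏_{j < i+1} x_j = x_0 ∏_{j < i} x_{j+1}`. [folklore] -/
theorem pprodLt_succ {n : ℕ} (x : Fin (n + 1) → ℝ) (i : Fin n) : pprodLt x i.succ = x 0 * pprodLt (fun j => x j.succ) i := by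
  rw [pprodLt, pprodLt, Finset.prod_filter, Finset.prod_filter, Fin.prod_univ_succ, if_pos (Fin.succ_pos _)]
  congr 1
  exact Finset.prod_congr rfl fun j _ => by simp only [Fin.succ_lt_succ_iff]

namespace DirData

variable (Δ : DirData ι mm)

/-- The pole of a letter of direction data at rider values `s`: `0` for the axis, `−M/N` for a
divisor. [folklore] -/
def poleR (s : Fin mm → ℝ) : Option ι → ℝ := fun a => a.elim 0 fun ℓ => -aeval s (Δ.M ℓ) / aeval s (Δ.N ℓ)

/-- The head factor of the peeling in simplex form: `c_{d a}(t₀)/x₀ = c̄τ/(c̄τx₀ − pole)` for a live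
letter. [folklore] -/
theorem cR_div_eq (s : Fin mm → ℝ) (a : Option ι) (ha : ∀ ℓ, a = some ℓ → aeval s (Δ.N ℓ) ≠ 0) {cτ x0 : ℝ} (hcτ : cτ ≠ 0)
    (hx0 : x0 ≠ 0) (hden : ∀ ℓ, a = some ℓ → aeval s (Δ.N ℓ) * (cτ * x0) + aeval s (Δ.M ℓ) ≠ 0) :
    (Δ.d a).cR s (cτ * x0) / x0 = cτ / (cτ * x0 - Δ.poleR s a) := by
  cases a with
  | none =>
    simp only [d, Option.elim, Letter.cR_inv, poleR, sub_zero]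
    rw [div_eq_div_iff hx0 (mul_ne_zero hcτ hx0)]; ring
  | some ℓ =>
    have hN := ha ℓ rfl
    have hD := hden ℓ rfl
    have hD' : cτ * x0 * aeval s (Δ.N ℓ) + aeval s (Δ.M ℓ) ≠ 0 := fun h => hD (by linear_combination h)
    simp only [d, Option.elim, Letter.cR_reg, poleR]
    rw [div_div, neg_div, sub_neg_eq_add, add_div' _ _ _ hN, div_div_eq_mul_div, div_eq_div_iff (mul_ne_zero hD hx0) hD']
    ring

/-- **The word function in simplex form.** For a non-empty word `v` over `Option ι` not ending in the
axis letter, all of whose divisor letters are LIVE at the rider values (`N ≠ 0`), at a point with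
positive word coordinates and positive scale,
`c̄τ · Z_v(x; s; τ) = ∏ᵢ (c̄τ ∏_{j<i} x_j)/(c̄τ ∏_{j≤i} x_j − pole(vᵢ))` — the pull-back of the simplex
integrand `∏ dtᵢ/(tᵢ − poleᵢ)` along `tᵢ = c̄τ x₀ ⋯ xᵢ`, Jacobian included.
[cite: KontsevichZagier2001, §1.2] -/
theorem scale_mul_fn_Zw : ∀ (v : List (Option ι)), v ≠ [] → v.getLast? ≠ some none →
    ∀ (z : Fin ((v.length + mm) + 1) → ℝ), z ∈ KZ.cube ((v.length + mm) + 1) → (∀ j, 0 < wX z j) → 0 < wScale z → 0 < Δ.c →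
    (∀ ℓ, some ℓ ∈ v → aeval (wRider z) (Δ.N ℓ) ≠ 0) →
    (Δ.c : ℝ) * wScale z * (Zw Δ.c Δ.hc Δ.d Δ.hd v).fn z =
      ∏ i : Fin v.length, ((Δ.c : ℝ) * wScale z * pprodLt (wX z) i) / ((Δ.c : ℝ) * wScale z * pprodLe (wX z) i - Δ.poleR (wRider z) (v.get i))
  | [], hv, _, _, _, _, _, _, _ => (hv rfl).elim
  | [a], _, hlast, z, hz, hx, hτ, hc, hlive => by
    have hcτ : (Δ.c : ℝ) * wScale z ≠ 0 := (mul_pos (by exact_mod_cast hc) hτ).ne'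
    have hx0 : wX z 0 ≠ 0 := (hx 0).ne'
    rw [fn_Zw_singleton]
    show (Δ.c : ℝ) * wScale z * (Δ.d a).lastR (wRider z) (Δ.c * wScale z * wX z 0) = ∏ i : Fin 1, _
    rw [Fin.prod_univ_one]
    show _ = (Δ.c : ℝ) * wScale z * pprodLt (wX z) 0 / ((Δ.c : ℝ) * wScale z * pprodLe (wX z) 0 - Δ.poleR (wRider z) a)
    rw [pprodLt_zero, pprodLe_zero, mul_one]
    cases a with
    | none => exact absurd rfl hlast
    | some ℓ =>
      have hN := hlive ℓ (by simp)
      have hD : aeval (wRider z) (Δ.N ℓ) * (Δ.c * wScale z * wX z 0) + aeval (wRider z) (Δ.M ℓ) ≠ 0 := by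
        have := Δ.reg ℓ (wRider z) (fun j => hz _) (Δ.c * wScale z * wX z 0)
          (mul_nonneg (mul_nonneg (by exact_mod_cast hc.le) hτ.le) (hx 0).le)
          (by
            have h1 : wScale z ≤ 1 := (hz _).2
            have h2 : wX z 0 ≤ 1 := (hz _).2
            have h3 : 0 ≤ wX z 0 := (hx 0).le
            have hc' : (0 : ℝ) ≤ Δ.c := by exact_mod_cast hc.le
            calc (Δ.c : ℝ) * wScale z * wX z 0 ≤ Δ.c * 1 * 1 := by gcongr
              _ = Δ.c := by ring)
        exact this
      have hD' : (Δ.c : ℝ) * wScale z * wX z 0 * aeval (wRider z) (Δ.N ℓ) + aeval (wRider z) (Δ.M ℓ) ≠ 0 :=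
        fun h => hD (by linear_combination h)
      simp only [DirData.d, Option.elim, Letter.lastR_reg, DirData.poleR]
      rw [mul_div_assoc', neg_div, sub_neg_eq_add, add_div' _ _ _ hN, div_div_eq_mul_div, div_eq_div_iff hD hD']
      ring
  | a :: b :: v, _, hlast, z, hz, hx, hτ, hc, hlive => by
    have hv0 : (b :: v) ≠ [] := List.cons_ne_nil _ _
    have hlast' : (b :: v).getLast? ≠ some none := by
      intro h; apply hlast; rw [← h]; simp [List.getLast?_cons_cons]
    have hcτ : (Δ.c : ℝ) * wScale z ≠ 0 := (mul_pos (by exact_mod_cast hc) hτ).ne'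
    have hx0 : wX z 0 ≠ 0 := (hx 0).ne'
    -- the induction hypothesis at the peeled point
    have IH := scale_mul_fn_Zw (b :: v) hv0 hlast' (peelPt z) (peelPt_mem hz) (fun j => by rw [wX_peelPt]; exact hx _)
      (by rw [wScale_peelPt]; exact mul_pos hτ (hx 0)) hc (fun ℓ hℓ => by rw [wRider_peelPt]; exact hlive ℓ (List.mem_cons_of_mem _ hℓ))
    rw [fn_Zw_cons _ _ _ _ _ _ hv0 z hz]
    -- split the head factor
    have hsplit : (Δ.c : ℝ) * wScale z * ((Δ.d a).cR (wRider z) (Δ.c * wScale z * wX z 0) * (Zw Δ.c Δ.hc Δ.d Δ.hd (b :: v)).fn (peelPt z)) =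
        ((Δ.d a).cR (wRider z) (Δ.c * wScale z * wX z 0) / wX z 0) *
          ((Δ.c : ℝ) * wScale (peelPt z) * (Zw Δ.c Δ.hc Δ.d Δ.hd (b :: v)).fn (peelPt z)) := by
      rw [wScale_peelPt]; field_simp
    rw [hsplit, IH]
    show _ = ∏ i : Fin ((b :: v).length + 1), ((Δ.c : ℝ) * wScale z * pprodLt (wX z) i) /
      ((Δ.c : ℝ) * wScale z * pprodLe (wX z) i - Δ.poleR (wRider z) ((a :: b :: v).get i))
    rw [Fin.prod_univ_succ]
    congr 1
    · -- the head factor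
      show _ = (Δ.c : ℝ) * wScale z * pprodLt (wX z) 0 / ((Δ.c : ℝ) * wScale z * pprodLe (wX z) 0 - Δ.poleR (wRider z) a)
      rw [pprodLt_zero, pprodLe_zero, mul_one]
      refine Δ.cR_div_eq (wRider z) a (fun ℓ hℓ => hlive ℓ (by rw [hℓ]; simp)) hcτ hx0 fun ℓ hℓ => ?_
      subst hℓ
      exact Δ.reg ℓ (wRider z) (fun j => hz _) (Δ.c * wScale z * wX z 0)
        (mul_nonneg (mul_nonneg (by exact_mod_cast hc.le) hτ.le) (hx 0).le)
        (by
          have h1 : wScale z ≤ 1 := (hz _).2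
          have h2 : wX z 0 ≤ 1 := (hz _).2
          have h3 : 0 ≤ wX z 0 := (hx 0).le
          have hc' : (0 : ℝ) ≤ Δ.c := by exact_mod_cast hc.le
          calc (Δ.c : ℝ) * wScale z * wX z 0 ≤ Δ.c * 1 * 1 := by gcongr
            _ = Δ.c := by ring)
    · -- the tail factors
      refine Finset.prod_congr rfl fun i _ => ?_
      show (Δ.c : ℝ) * wScale (peelPt z) * pprodLt (wX (peelPt z)) i /
          ((Δ.c : ℝ) * wScale (peelPt z) * pprodLe (wX (peelPt z)) i - Δ.poleR (wRider (peelPt z)) ((b :: v).get i)) =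
        (Δ.c : ℝ) * wScale z * pprodLt (wX z) i.succ / ((Δ.c : ℝ) * wScale z * pprodLe (wX z) i.succ - Δ.poleR (wRider z) ((a :: b :: v).get i.succ))
      have hwx : wX (peelPt z) = fun j => wX z j.succ := funext (wX_peelPt z)
      rw [wScale_peelPt, wRider_peelPt, hwx, pprodLt_succ, pprodLe_succ, List.get_cons_succ']
      ring_nf

end DirData

end ClosedForm

/-! ## The bridge: simplex families of a corner chart versus the cube series -/

section Bridge

open Shuffle NCSeries

variable {ι : Type} {mm : ℕ}

/-- **Dead letters kill the word function**: if a divisor letter of `v` has `N = 0` at the rider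
values, `Z_v = 0` there. [folklore] -/
theorem DirData.fn_Zw_eq_zero_of_dead (Δ : DirData ι mm) (v : List (Option ι)) (z : Fin ((v.length + mm) + 1) → ℝ)
    {ℓ : ι} (hℓ : some ℓ ∈ v) (hN : aeval (wRider z) (Δ.N ℓ) = 0) : (Zw Δ.c Δ.hc Δ.d Δ.hd v).fn z = 0 := by
  obtain ⟨i, hi⟩ := List.mem_iff_get.mp hℓ
  rw [RFun.fn, Zw, div_eq_zero_iff]
  left
  rw [map_mul, map_prod]
  by_cases hlt : i.val + 1 < v.length
  · refine mul_eq_zero_of_left (Finset.prod_eq_zero (i := i) (Finset.mem_filter.mpr ⟨Finset.mem_univ _, hlt⟩) ?_) _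
    rw [hi]; simp only [DirData.d, Option.elim, Letter.cfNum_reg, map_mul, aeval_emb, hN, zero_mul]
  · refine mul_eq_zero_of_right _ ?_
    have hi' : v.length - 1 = i.val := by have := i.isLt; omega
    have hlast : v.getLast? = some (some ℓ) := by
      rw [List.getLast?_eq_getElem?, hi', List.getElem?_eq_getElem i.isLt, ← List.get_eq_getElem, hi]
    simp only [hlast, DirData.d, Option.elim, Letter.lastNum_reg, aeval_emb, hN]

variable {R : Type} [CommRing R] [Algebra ℚ R] {χ : KZ.FormalRep →+ R} (hrel : ∀ c ∈ KZ.relations, χ c = 0)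

/-- The rational constant value of a rider-free polynomial. [folklore] -/
def cval (P : MvPolynomial (Fin (0 + 0)) ℚ) : ℚ := MvPolynomial.eval (fun _ : Fin (0 + 0) => (0 : ℚ)) P

omit [Algebra ℚ R] in
/-- A rider-free polynomial is its constant value at every (the) rider point. [folklore] -/
theorem aeval_eq_cval (P : MvPolynomial (Fin (0 + 0)) ℚ) (s : Fin (0 + 0) → ℝ) : aeval s P = (cval P : ℝ) := by
  have hs : s = fun i : Fin (0 + 0) => (((fun _ : Fin (0 + 0) => (0 : ℚ)) i : ℚ) : ℝ) := funext fun i => Fin.elim0 i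
  rw [hs, aeval_ratCast, cval]

/-- The rational pole of a letter of rider-free direction data. [folklore] -/
def DirData.poleQ (Δ : DirData ι (0 + 0)) : Option ι → ℚ := fun a => a.elim 0 fun ℓ => -cval (Δ.M ℓ) / cval (Δ.N ℓ)

omit [Algebra ℚ R] in
/-- The real pole is the rational pole. [folklore] -/
theorem DirData.poleR_eq (Δ : DirData ι (0 + 0)) (s : Fin (0 + 0) → ℝ) (a : Option ι) : Δ.poleR s a = (Δ.poleQ a : ℝ) := by
  cases a with
  | none => simp [DirData.poleR, DirData.poleQ]
  | some ℓ => simp only [DirData.poleR, DirData.poleQ, Option.elim, aeval_eq_cval]; push_cast; ring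

include hrel in
omit [Algebra ℚ R] in
/-- **Dead words have vanishing cube coefficient.** [folklore] -/
theorem DirData.zcoef_eq_zero_of_dead (Δ : DirData ι (0 + 0)) (v : List (Option ι)) {ℓ : ι} (hℓ : some ℓ ∈ v) (hN : cval (Δ.N ℓ) = 0) :
    zcoef (χ := χ) (m := 0) (k := 0) Δ.c Δ.hc Δ.d Δ.hd (RFun.const 1) 1 isScale_one0 v = 0 := by
  rw [zcoef]
  refine RFun.chi_eq_zero hrel fun y _ => ?_
  rw [fn_famTerm, Δ.fn_Zw_eq_zero_of_dead v _ hℓ (by rw [aeval_eq_cval, hN, Rat.cast_zero]), mul_zero]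

omit [Algebra ℚ R] in
/-- Reindexing partial products along a cast. [folklore] -/
theorem pprodLt_cast {n n' : ℕ} (h : n = n') (x : Fin n' → ℝ) (i : Fin n) :
    pprodLt (fun j => x (Fin.cast h j)) i = pprodLt x (Fin.cast h i) := by
  subst h; rfl

omit [Algebra ℚ R] in
/-- Reindexing partial products along a cast. [folklore] -/
theorem pprodLe_cast {n n' : ℕ} (h : n = n') (x : Fin n' → ℝ) (i : Fin n) :
    pprodLe (fun j => x (Fin.cast h j)) i = pprodLe x (Fin.cast h i) := by
  subst h; rfl

omit [Algebra ℚ R] in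
/-- `⟨χ, (map g)_* F⟩ = ⟨χ ∘ map g, F⟩` across alphabets. [folklore] -/
theorem pair_mapDomain' {α β K : Type} [AddCommMonoid K] [Module ℚ K] (χ' : List β → K) (g : List α → List β) (F : List α →₀ ℚ) :
    pair χ' (F.mapDomain g) = pair (χ' ∘ g) F := by
  simp only [pair]
  rw [Finsupp.sum_mapDomain_index (by simp) (by intros; simp [add_smul])]
  rfl

omit [Algebra ℚ R] in
/-- Words in the support of `regEnd x W` carry every letter of `W`. [folklore] -/
theorem mem_of_mem_support_regEnd {α : Type} [DecidableEq α] (x : α) (W : List α) {u : List α} (hu : u ∈ (regEnd x W).support)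
    {a : α} (ha : a ∈ W) : a ∈ u := by
  have h := count_eq_of_mem_support_regEnd x W hu a
  exact List.count_pos_iff.mp (by rw [h]; exact List.count_pos_iff.mpr ha)


end Bridge

end Literature.NumberTheory.Transcendental.KZ.Cube
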